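import Summits.NavierStokesRegularity.NavierStokesRegularity.Theses.RellichScar
import Summits.NavierStokesRegularity.NavierStokesRegularity.Theorems.ScarRigidity.Negative.LogicAndLoadBearing
import Literature.Analysis.FluidPDE.TypeIAncientMild
import Literature.Analysis.FluidPDE.ParasiticSlabFlow
import Summits.NavierStokesRegularity.NavierStokesRegularity.Theorems.RellichScarScarRigidityCoulombGreen
import Summits.NavierStokesRegularity.NavierStokesRegularity.Theorems.RellichScarScarRigidityLogConvexityL2Energy
import HarnessLib

/-!
# `ScarRigidity` — line `finite-energy-log-convexity`, stub `stub_coulombEnergyPackage`: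
# integrability of the pairings of the Coulomb package (crux stmt-NavierStokesRegularity-11717)

Helper file 10 of S4-E (`stub_coulombEnergyPackage`). The pairing bound of the Agmon–Nirenberg frame
(`abs_integral_inner_linConvect_le`, `…LogConvexityPairing`) is applied to the test fields
`φ = k w + l ψ` (`k, l ∈ ℝ`, `ψ = Γ ⋆ w` the Newtonian potential, `w = V₁ - V₂`); it asks for eight
integrability hypotheses, which this file derives from the decay of an apex configuration:
`‖Vⱼ‖ ≤ C_V (1+‖x‖)⁻¹`, `‖DV₁‖ ≤ B₁ (1+‖x‖)⁻²`, `‖w‖ ≤ A (1+‖x‖)⁻³`, `‖Dw‖ ≤ A₁ (1+‖x‖)⁻²`,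
`‖ψ‖ ≤ P₀ ‖x‖^{-3/4}`, `‖Dψ‖ ≤ P₁ (1+‖x‖)^{-7/4}` (`pairing_integrability`); and it records the
conversion `M/(‖x‖+a)ᵏ ≤ M (min 1 a)⁻ᵏ (1+‖x‖)⁻ᵏ` from the apex weights of the line to the weights of
the Green file (`div_norm_add_pow_le_one_add_norm_rpow`).
-/

noncomputable section

open Set Filter Function MeasureTheory Metric TopologicalSpace
open scoped Topology ENNReal NNReal InnerProductSpace RealInnerProductSpace
open Literature.Analysis.FluidPDE
open Summit.NavierStokesRegularity.NavierStokesRegularity.Theses.RellichScar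
open Summit.NavierStokesRegularity.NavierStokesRegularity.Theorems.ScarRigidity.Negative

set_option linter.dupNamespace false

namespace Summit.NavierStokesRegularity.NavierStokesRegularity.Theorems.RellichScarScarRigidity

open Real

/-! ## From apex weights to `(1 + ‖x‖)⁻ᵏ` -/

/-- **`M/(‖x‖+a)ᵏ ≤ M (min 1 a)⁻ᵏ (1+‖x‖)⁻ᵏ`** for `a > 0`, `M ≥ 0` (`min(1,a)(1+‖x‖) ≤ ‖x‖ + a`). [folklore] -/
theorem div_norm_add_pow_le_one_add_norm_rpow {E : Type*} [NormedAddCommGroup E] {a M : ℝ}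
    (ha : 0 < a) (hM : 0 ≤ M) (k : ℕ) (x : E) :
    M / (‖x‖ + a) ^ k ≤ M * ((min 1 a)⁻¹) ^ k * (1 + ‖x‖) ^ (-(k : ℝ)) := by
  have hm : 0 < min 1 a := lt_min one_pos ha
  have hx1 : 0 < 1 + ‖x‖ := by positivity
  have hle : (min 1 a * (1 + ‖x‖)) ^ k ≤ (‖x‖ + a) ^ k :=
    pow_le_pow_left₀ (by positivity) (min_one_mul_one_add_norm_le a x) k
  rw [div_eq_mul_inv, Real.rpow_neg hx1.le, Real.rpow_natCast, mul_assoc]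
  refine mul_le_mul_of_nonneg_left ?_ hM
  calc ((‖x‖ + a) ^ k)⁻¹ ≤ ((min 1 a * (1 + ‖x‖)) ^ k)⁻¹ := inv_anti₀ (by positivity) hle
    _ = ((min 1 a)⁻¹) ^ k * ((1 + ‖x‖) ^ k)⁻¹ := by rw [mul_pow, mul_inv, inv_pow]

/-! ## Integrability of the pairings -/

/-- Integrability from a two-term majorant `M₁ (1+‖x‖)^{-r} + M₂ (1+‖x‖)^{-r'} ‖x‖^{-3/4}` with
`r > 3`, `r' ≥ 0`, `r' + 3/4 > 3`. [folklore] -/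
theorem integrable_of_le_two_weights {F : Type*} [NormedAddCommGroup F]
    {f : (EuclideanSpace ℝ (Fin 3)) → F} (hf : AEStronglyMeasurable f volume) {M₁ M₂ r r' : ℝ}
    (hr : 3 < r) (hr' : 0 ≤ r') (hrs : 3 < r' + 3 / 4)
    (h : ∀ x, x ≠ 0 → ‖f x‖ ≤ M₁ * (1 + ‖x‖) ^ (-r) + M₂ * ((1 + ‖x‖) ^ (-r') * ‖x‖ ^ (-(3 / 4 : ℝ)))) :
    Integrable f volume := by
  have hr3 : (Module.finrank ℝ (EuclideanSpace ℝ (Fin 3)) : ℝ) < r := by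
    rw [finrank_euclideanSpace, Fintype.card_fin]; exact_mod_cast hr
  have hmaj := ((integrable_one_add_norm hr3).const_mul M₁).add
    ((integrable_one_add_norm_rpow_mul_rpow hr' (by norm_num) hrs).const_mul M₂)
  refine hmaj.mono' hf ?_
  have hae : ∀ᵐ x ∂(volume : Measure (EuclideanSpace ℝ (Fin 3))), x ≠ (0 : EuclideanSpace ℝ (Fin 3)) := by
    rw [ae_iff]; simp [measure_singleton]
  filter_upwards [hae] with x hx using h x hx

/-- **The eight integrability hypotheses of the pairing bound** for the test field `φ = k w + l ψ`
of an apex configuration (`abs_integral_inner_linConvect_le` with `V₁, V₂, w, φ`). [folklore] -/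
theorem pairing_integrability
    {V₁ V₂ w ψ : (EuclideanSpace ℝ (Fin 3)) → (EuclideanSpace ℝ (Fin 3))}
    (hV₁ : ContDiff ℝ 1 V₁) (hV₂ : ContDiff ℝ 1 V₂) (hw : ContDiff ℝ 1 w) (hψ : ContDiff ℝ 1 ψ)
    {Cv B₁ A A₁ P₀ P₁ : ℝ} (hCv : 0 ≤ Cv) (hB₁ : 0 ≤ B₁) (hA : 0 ≤ A) (hA₁ : 0 ≤ A₁) (hP₀ : 0 ≤ P₀)
    (hP₁ : 0 ≤ P₁)
    (hV₁b : ∀ x, ‖V₁ x‖ ≤ Cv * (1 + ‖x‖) ^ (-(1 : ℝ))) (hV₂b : ∀ x, ‖V₂ x‖ ≤ Cv * (1 + ‖x‖) ^ (-(1 : ℝ)))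
    (hDV₁ : ∀ x, ‖fderiv ℝ V₁ x‖ ≤ B₁ * (1 + ‖x‖) ^ (-(2 : ℝ)))
    (hwb : ∀ x, ‖w x‖ ≤ A * (1 + ‖x‖) ^ (-(3 : ℝ)))
    (hw1 : ∀ x, ‖fderiv ℝ w x‖ ≤ A₁ * (1 + ‖x‖) ^ (-(2 : ℝ)))
    (hψ0 : ∀ x, x ≠ 0 → ‖ψ x‖ ≤ P₀ * ‖x‖ ^ (-(3 / 4 : ℝ)))
    (hψ1 : ∀ x, ‖fderiv ℝ ψ x‖ ≤ P₁ * (1 + ‖x‖) ^ (-(7 / 4 : ℝ))) (k l : ℝ) :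
    Integrable (fun x => ⟪V₁ x, k • w x + l • ψ x⟫ • w x) volume ∧
    Integrable (fun x => ⟪convect w V₁ x, k • w x + l • ψ x⟫) volume ∧
    Integrable (fun x => ⟪V₁ x, convect w (fun y => k • w y + l • ψ y) x⟫) volume ∧
    Integrable (fun x => ⟪w x, k • w x + l • ψ x⟫ • V₂ x) volume ∧
    Integrable (fun x => ⟪convect V₂ w x, k • w x + l • ψ x⟫) volume ∧
    Integrable (fun x => ⟪w x, convect V₂ (fun y => k • w y + l • ψ y) x⟫) volume ∧
    Integrable (fun x => ‖w x‖ ^ 2) volume ∧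
    Integrable (fun x => ‖fderiv ℝ (fun y => k • w y + l • ψ y) x‖ ^ 2) volume := by
  -- the derivative of the test field
  have hφ : ContDiff ℝ 1 fun y => k • w y + l • ψ y := (hw.const_smul k).add (hψ.const_smul l)
  have hDφ : ∀ x, fderiv ℝ (fun y => k • w y + l • ψ y) x = k • fderiv ℝ w x + l • fderiv ℝ ψ x := fun x =>
    ((((hw.differentiable one_ne_zero) x).hasFDerivAt.const_smul k).add
      (((hψ.differentiable one_ne_zero) x).hasFDerivAt.const_smul l)).fderiv
  -- sizes
  have h74 : ∀ x : EuclideanSpace ℝ (Fin 3), (1 + ‖x‖) ^ (-(2 : ℝ)) ≤ (1 + ‖x‖) ^ (-(7 / 4 : ℝ)) :=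
    fun x => Real.rpow_le_rpow_of_exponent_le (by linarith [norm_nonneg x]) (by norm_num)
  have hDφb : ∀ x, ‖fderiv ℝ (fun y => k • w y + l • ψ y) x‖ ≤
      (|k| * A₁ + |l| * P₁) * (1 + ‖x‖) ^ (-(7 / 4 : ℝ)) := by
    intro x
    rw [hDφ]
    calc ‖k • fderiv ℝ w x + l • fderiv ℝ ψ x‖ ≤ ‖k • fderiv ℝ w x‖ + ‖l • fderiv ℝ ψ x‖ := norm_add_le _ _
      _ ≤ |k| * (A₁ * (1 + ‖x‖) ^ (-(2 : ℝ))) + |l| * (P₁ * (1 + ‖x‖) ^ (-(7 / 4 : ℝ))) := by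
          rw [norm_smul, norm_smul, Real.norm_eq_abs, Real.norm_eq_abs]
          exact add_le_add (mul_le_mul_of_nonneg_left (hw1 x) (abs_nonneg _))
            (mul_le_mul_of_nonneg_left (hψ1 x) (abs_nonneg _))
      _ ≤ |k| * (A₁ * (1 + ‖x‖) ^ (-(7 / 4 : ℝ))) + |l| * (P₁ * (1 + ‖x‖) ^ (-(7 / 4 : ℝ))) :=
          add_le_add (mul_le_mul_of_nonneg_left (mul_le_mul_of_nonneg_left (h74 x) hA₁) (abs_nonneg _))
            le_rfl
      _ = (|k| * A₁ + |l| * P₁) * (1 + ‖x‖) ^ (-(7 / 4 : ℝ)) := by ring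
  have hφb : ∀ x, x ≠ 0 → ‖k • w x + l • ψ x‖ ≤
      |k| * A * (1 + ‖x‖) ^ (-(3 : ℝ)) + |l| * P₀ * ‖x‖ ^ (-(3 / 4 : ℝ)) := by
    intro x hx
    calc ‖k • w x + l • ψ x‖ ≤ ‖k • w x‖ + ‖l • ψ x‖ := norm_add_le _ _
      _ ≤ |k| * (A * (1 + ‖x‖) ^ (-(3 : ℝ))) + |l| * (P₀ * ‖x‖ ^ (-(3 / 4 : ℝ))) := by
          rw [norm_smul, norm_smul, Real.norm_eq_abs, Real.norm_eq_abs]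
          exact add_le_add (mul_le_mul_of_nonneg_left (hwb x) (abs_nonneg _))
            (mul_le_mul_of_nonneg_left (hψ0 x hx) (abs_nonneg _))
      _ = |k| * A * (1 + ‖x‖) ^ (-(3 : ℝ)) + |l| * P₀ * ‖x‖ ^ (-(3 / 4 : ℝ)) := by ring
  -- continuity
  have hcφ : Continuous fun y => k • w y + l • ψ y := hφ.continuous
  have hcDφ : Continuous fun x => fderiv ℝ (fun y => k • w y + l • ψ y) x := hφ.continuous_fderiv one_ne_zero
  have hcw : Continuous w := hw.continuous
  have hcDw : Continuous (fderiv ℝ w) := hw.continuous_fderiv one_ne_zero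
  have hcDV₁ : Continuous (fderiv ℝ V₁) := hV₁.continuous_fderiv one_ne_zero
  have hcc1 : Continuous fun x => convect w V₁ x := by
    simp only [convect_apply]; exact hcDV₁.clm_apply hcw
  have hcc2 : Continuous fun x => convect w (fun y => k • w y + l • ψ y) x := by
    simp only [convect_apply]; exact hcDφ.clm_apply hcw
  have hcc3 : Continuous fun x => convect V₂ w x := by
    simp only [convect_apply]; exact hcDw.clm_apply hV₂.continuous
  have hcc4 : Continuous fun x => convect V₂ (fun y => k • w y + l • ψ y) x := by
    simp only [convect_apply]; exact hcDφ.clm_apply hV₂.continuous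
  have hi0 : Continuous fun x => ⟪V₁ x, k • w x + l • ψ x⟫ := hV₁.continuous.inner hcφ
  have hi0' : Continuous fun x => ⟪w x, k • w x + l • ψ x⟫ := hcw.inner hcφ
  have hm0 : Continuous fun x => ⟪V₁ x, k • w x + l • ψ x⟫ • w x := hi0.smul hcw
  have hm0' : Continuous fun x => ⟪w x, k • w x + l • ψ x⟫ • V₂ x := hi0'.smul hV₂.continuous
  refine ⟨?_, ?_, ?_, ?_, ?_, ?_, ?_, ?_⟩
  · -- `⟪V₁, φ⟫ w`
    refine integrable_of_le_two_weights (f := fun x => ⟪V₁ x, k • w x + l • ψ x⟫ • w x)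
      hm0.aestronglyMeasurable (M₁ := Cv * (|k| * A) * A)
      (M₂ := Cv * (|l| * P₀) * A) (r := 7) (r' := 4) (by norm_num) (by norm_num) (by norm_num) fun x hx => ?_
    rw [norm_smul]
    calc ‖⟪V₁ x, k • w x + l • ψ x⟫‖ * ‖w x‖
        ≤ (Cv * (1 + ‖x‖) ^ (-(1 : ℝ)) * (|k| * A * (1 + ‖x‖) ^ (-(3 : ℝ)) + |l| * P₀ * ‖x‖ ^ (-(3 / 4 : ℝ)))) *
            (A * (1 + ‖x‖) ^ (-(3 : ℝ))) :=
          mul_le_mul (norm_inner_le_of_le (hV₁b x) (hφb x hx) (by positivity)) (hwb x) (norm_nonneg _)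
            (by positivity)
      _ = Cv * (|k| * A) * A * ((1 + ‖x‖) ^ (-(1 : ℝ)) * (1 + ‖x‖) ^ (-(3 : ℝ)) * (1 + ‖x‖) ^ (-(3 : ℝ))) +
            Cv * (|l| * P₀) * A * (((1 + ‖x‖) ^ (-(1 : ℝ)) * (1 + ‖x‖) ^ (-(3 : ℝ))) * ‖x‖ ^ (-(3 / 4 : ℝ))) := by
          ring
      _ = _ := by simp only [one_add_norm_rpow_mul]; norm_num
  · -- `⟪(w·∇)V₁, φ⟫`
    refine integrable_of_le_two_weights (f := fun x => ⟪convect w V₁ x, k • w x + l • ψ x⟫)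
      (hcc1.inner hcφ).aestronglyMeasurable (M₁ := B₁ * A * (|k| * A))
      (M₂ := B₁ * A * (|l| * P₀)) (r := 8) (r' := 5) (by norm_num) (by norm_num) (by norm_num) fun x hx => ?_
    have hc : ‖convect w V₁ x‖ ≤ B₁ * (1 + ‖x‖) ^ (-(2 : ℝ)) * (A * (1 + ‖x‖) ^ (-(3 : ℝ))) := by
      rw [convect_apply]
      exact (ContinuousLinearMap.le_opNorm (fderiv ℝ V₁ x) (w x)).trans
        (mul_le_mul (hDV₁ x) (hwb x) (norm_nonneg _) (by positivity))
    calc ‖⟪convect w V₁ x, k • w x + l • ψ x⟫‖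
        ≤ B₁ * (1 + ‖x‖) ^ (-(2 : ℝ)) * (A * (1 + ‖x‖) ^ (-(3 : ℝ))) *
            (|k| * A * (1 + ‖x‖) ^ (-(3 : ℝ)) + |l| * P₀ * ‖x‖ ^ (-(3 / 4 : ℝ))) :=
          norm_inner_le_of_le hc (hφb x hx) (by positivity)
      _ = B₁ * A * (|k| * A) * ((1 + ‖x‖) ^ (-(2 : ℝ)) * (1 + ‖x‖) ^ (-(3 : ℝ)) * (1 + ‖x‖) ^ (-(3 : ℝ))) +
            B₁ * A * (|l| * P₀) * (((1 + ‖x‖) ^ (-(2 : ℝ)) * (1 + ‖x‖) ^ (-(3 : ℝ))) * ‖x‖ ^ (-(3 / 4 : ℝ))) := by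
          ring
      _ = _ := by simp only [one_add_norm_rpow_mul]; norm_num
  · -- `⟪V₁, (w·∇)φ⟫`
    refine integrable_of_le_one_add_norm_rpow (f := fun x => ⟪V₁ x, convect w (fun y => k • w y + l • ψ y) x⟫)
      (hV₁.continuous.inner hcc2).aestronglyMeasurable
      (M := Cv * (|k| * A₁ + |l| * P₁) * A) (r := 23 / 4) (by norm_num) fun x => ?_
    have hc : ‖convect w (fun y => k • w y + l • ψ y) x‖ ≤
        (|k| * A₁ + |l| * P₁) * (1 + ‖x‖) ^ (-(7 / 4 : ℝ)) * (A * (1 + ‖x‖) ^ (-(3 : ℝ))) := by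
      rw [convect_apply]
      exact (ContinuousLinearMap.le_opNorm (fderiv ℝ (fun y => k • w y + l • ψ y) x) (w x)).trans
        (mul_le_mul (hDφb x) (hwb x) (norm_nonneg _) (by positivity))
    calc ‖⟪V₁ x, convect w (fun y => k • w y + l • ψ y) x⟫‖
        ≤ Cv * (1 + ‖x‖) ^ (-(1 : ℝ)) * ((|k| * A₁ + |l| * P₁) * (1 + ‖x‖) ^ (-(7 / 4 : ℝ)) * (A * (1 + ‖x‖) ^ (-(3 : ℝ)))) :=
          norm_inner_le_of_le (hV₁b x) hc (by positivity)
      _ = Cv * (|k| * A₁ + |l| * P₁) * A * ((1 + ‖x‖) ^ (-(1 : ℝ)) * (1 + ‖x‖) ^ (-(7 / 4 : ℝ)) * (1 + ‖x‖) ^ (-(3 : ℝ))) := by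
          ring
      _ = _ := by simp only [one_add_norm_rpow_mul]; norm_num
  · -- `⟪w, φ⟫ V₂`
    refine integrable_of_le_two_weights (f := fun x => ⟪w x, k • w x + l • ψ x⟫ • V₂ x)
      hm0'.aestronglyMeasurable (M₁ := A * (|k| * A) * Cv)
      (M₂ := A * (|l| * P₀) * Cv) (r := 7) (r' := 4) (by norm_num) (by norm_num) (by norm_num) fun x hx => ?_
    rw [norm_smul]
    calc ‖⟪w x, k • w x + l • ψ x⟫‖ * ‖V₂ x‖
        ≤ (A * (1 + ‖x‖) ^ (-(3 : ℝ)) * (|k| * A * (1 + ‖x‖) ^ (-(3 : ℝ)) + |l| * P₀ * ‖x‖ ^ (-(3 / 4 : ℝ)))) *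
            (Cv * (1 + ‖x‖) ^ (-(1 : ℝ))) :=
          mul_le_mul (norm_inner_le_of_le (hwb x) (hφb x hx) (by positivity)) (hV₂b x) (norm_nonneg _)
            (by positivity)
      _ = A * (|k| * A) * Cv * ((1 + ‖x‖) ^ (-(3 : ℝ)) * (1 + ‖x‖) ^ (-(3 : ℝ)) * (1 + ‖x‖) ^ (-(1 : ℝ))) +
            A * (|l| * P₀) * Cv * (((1 + ‖x‖) ^ (-(3 : ℝ)) * (1 + ‖x‖) ^ (-(1 : ℝ))) * ‖x‖ ^ (-(3 / 4 : ℝ))) := by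
          ring
      _ = _ := by simp only [one_add_norm_rpow_mul]; norm_num
  · -- `⟪(V₂·∇)w, φ⟫`
    refine integrable_of_le_two_weights (f := fun x => ⟪convect V₂ w x, k • w x + l • ψ x⟫)
      (hcc3.inner hcφ).aestronglyMeasurable (M₁ := A₁ * Cv * (|k| * A))
      (M₂ := A₁ * Cv * (|l| * P₀)) (r := 6) (r' := 3) (by norm_num) (by norm_num) (by norm_num) fun x hx => ?_
    have hc : ‖convect V₂ w x‖ ≤ A₁ * (1 + ‖x‖) ^ (-(2 : ℝ)) * (Cv * (1 + ‖x‖) ^ (-(1 : ℝ))) := by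
      rw [convect_apply]
      exact (ContinuousLinearMap.le_opNorm (fderiv ℝ w x) (V₂ x)).trans
        (mul_le_mul (hw1 x) (hV₂b x) (norm_nonneg _) (by positivity))
    calc ‖⟪convect V₂ w x, k • w x + l • ψ x⟫‖
        ≤ A₁ * (1 + ‖x‖) ^ (-(2 : ℝ)) * (Cv * (1 + ‖x‖) ^ (-(1 : ℝ))) *
            (|k| * A * (1 + ‖x‖) ^ (-(3 : ℝ)) + |l| * P₀ * ‖x‖ ^ (-(3 / 4 : ℝ))) :=
          norm_inner_le_of_le hc (hφb x hx) (by positivity)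
      _ = A₁ * Cv * (|k| * A) * ((1 + ‖x‖) ^ (-(2 : ℝ)) * (1 + ‖x‖) ^ (-(1 : ℝ)) * (1 + ‖x‖) ^ (-(3 : ℝ))) +
            A₁ * Cv * (|l| * P₀) * (((1 + ‖x‖) ^ (-(2 : ℝ)) * (1 + ‖x‖) ^ (-(1 : ℝ))) * ‖x‖ ^ (-(3 / 4 : ℝ))) := by
          ring
      _ = _ := by simp only [one_add_norm_rpow_mul]; norm_num
  · -- `⟪w, (V₂·∇)φ⟫`
    refine integrable_of_le_one_add_norm_rpow (f := fun x => ⟪w x, convect V₂ (fun y => k • w y + l • ψ y) x⟫)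
      (hcw.inner hcc4).aestronglyMeasurable
      (M := A * (|k| * A₁ + |l| * P₁) * Cv) (r := 23 / 4) (by norm_num) fun x => ?_
    have hc : ‖convect V₂ (fun y => k • w y + l • ψ y) x‖ ≤
        (|k| * A₁ + |l| * P₁) * (1 + ‖x‖) ^ (-(7 / 4 : ℝ)) * (Cv * (1 + ‖x‖) ^ (-(1 : ℝ))) := by
      rw [convect_apply]
      exact (ContinuousLinearMap.le_opNorm (fderiv ℝ (fun y => k • w y + l • ψ y) x) (V₂ x)).trans
        (mul_le_mul (hDφb x) (hV₂b x) (norm_nonneg _) (by positivity))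
    calc ‖⟪w x, convect V₂ (fun y => k • w y + l • ψ y) x⟫‖
        ≤ A * (1 + ‖x‖) ^ (-(3 : ℝ)) * ((|k| * A₁ + |l| * P₁) * (1 + ‖x‖) ^ (-(7 / 4 : ℝ)) * (Cv * (1 + ‖x‖) ^ (-(1 : ℝ)))) :=
          norm_inner_le_of_le (hwb x) hc (by positivity)
      _ = A * (|k| * A₁ + |l| * P₁) * Cv * ((1 + ‖x‖) ^ (-(3 : ℝ)) * (1 + ‖x‖) ^ (-(7 / 4 : ℝ)) * (1 + ‖x‖) ^ (-(1 : ℝ))) := by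
          ring
      _ = _ := by simp only [one_add_norm_rpow_mul]; norm_num
  · -- `‖w‖²`
    refine integrable_of_le_one_add_norm_rpow (hcw.norm.pow 2).aestronglyMeasurable (M := A ^ 2) (r := 6)
      (by norm_num) fun x => ?_
    rw [Real.norm_of_nonneg (sq_nonneg _)]
    calc ‖w x‖ ^ 2 ≤ (A * (1 + ‖x‖) ^ (-(3 : ℝ))) ^ 2 := pow_le_pow_left₀ (norm_nonneg _) (hwb x) 2
      _ = A ^ 2 * (1 + ‖x‖) ^ (-(6 : ℝ)) := by
          have h : ((1 + ‖x‖) ^ (-(3 : ℝ))) ^ 2 = (1 + ‖x‖) ^ (-(6 : ℝ)) := by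
            rw [← Real.rpow_natCast, ← Real.rpow_mul (by positivity)]; norm_num
          rw [mul_pow, h]
  · -- `‖Dφ‖²`
    refine integrable_of_le_one_add_norm_rpow (hcDφ.norm.pow 2).aestronglyMeasurable
      (M := (|k| * A₁ + |l| * P₁) ^ 2) (r := 7 / 2) (by norm_num) fun x => ?_
    rw [Real.norm_of_nonneg (sq_nonneg _)]
    calc ‖fderiv ℝ (fun y => k • w y + l • ψ y) x‖ ^ 2 ≤ ((|k| * A₁ + |l| * P₁) * (1 + ‖x‖) ^ (-(7 / 4 : ℝ))) ^ 2 :=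
          pow_le_pow_left₀ (norm_nonneg _) (hDφb x) 2
      _ = (|k| * A₁ + |l| * P₁) ^ 2 * (1 + ‖x‖) ^ (-(7 / 2 : ℝ)) := by
          have h : ((1 + ‖x‖) ^ (-(7 / 4 : ℝ))) ^ 2 = (1 + ‖x‖) ^ (-(7 / 2 : ℝ)) := by
            rw [← Real.rpow_natCast, ← Real.rpow_mul (by positivity)]; norm_num
          rw [mul_pow, h]

/-! ## Registered sub-goal (helper stub of `stub_coulombEnergyPackage`) -/

/-- **Registered helper stub `stub_apexWeightComparison`** (crux stmt-NavierStokesRegularity-11717,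
line `finite-energy-log-convexity`, helper of S4-E): the apex weights of the line are dominated by the
`(1+‖x‖)⁻ᵏ` weights of the Green file, as registered. [folklore] -/
theorem stub_apexWeightComparison :
    ∀ (a M : ℝ) (k : ℕ) (x : EuclideanSpace ℝ (Fin 3)), 0 < a → 0 ≤ M →
      M / (‖x‖ + a) ^ k ≤ M * ((min 1 a)⁻¹) ^ k * (1 + ‖x‖) ^ (-(k : ℝ)) :=
  fun _a _M k x ha hM => div_norm_add_pow_le_one_add_norm_rpow ha hM k x

end Summit.NavierStokesRegularity.NavierStokesRegularity.Theorems.RellichScarScarRigidity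

end
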